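import Literature.NumberTheory.Transcendental.BakerQuantObstruction
import Literature.NumberTheory.Transcendental.SixExponentialsSeveralVariablesExtremal
import Mathlib.LinearAlgebra.LinearIndependent.BaseChange
import Mathlib.LinearAlgebra.Basis.Fin
import HarnessLib

/-!
# The strong six exponentials theorem, I: linear algebra over `ℚ ⊆ K₀ ⊆ ℂ`

Topic `Literature/NumberTheory/Transcendental`. First file of the proof of the strong six
exponentials theorem (`Literature.Barriers.Schanuel.roy1992_strongSixExponentials`; Roy 1992 §4
Cor. 2, [Waldschmidt2005, Thm 2.1], equivalently [Waldschmidt2005, Thm 3.1] for `d = 2`) by a direct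
run of Waldschmidt's linear subgroup theorem on `𝔾ₐ × 𝔾ₘ^N` (`LinearSubgroupGaGm*.lean`,
`linearSubgroup_GaGm`). The obstructing subgroup `G' = V' × T_M` produced by that theorem is
excluded by rationality arguments; this file collects the field-independent linear algebra they
use (`F ⊆ ℂ` a subfield, in the application the coefficient field `K₀`):

* `exists_adapted_basis` — a subspace `V ⊆ ℂ × ℂ^N` containing `e₀` with `e₀.1 = 1` has a basis
  `b₀ = e₀`, `bᵢ.1 = 0` (`Basis.mkFinCons`), the shape used by `exists_auxiliaryPolynomial`;
* `exists_basis_head_one` — a finite-dimensional `ℚ`-algebra (a number field) has a `ℚ`-basis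
  `ω₀ = 1, ω₁, …`;
* base change of linear (in)dependence (Mathlib `linearIndependent_algebraMap_comp_iff`):
  integer characters independent over `ℤ` stay independent over `F` and `ℂ`
  (`linearIndependent_cast_of_int`), an `F`-vector in the `ℂ`-span of `F`-independent `F`-vectors
  is in their `F`-span (`mem_span_of_mem_span_map`, "rational choice"), and the same for a pencil
  `αu + βu'` (`exists_pencil_of_exists_pencil_map`);
* `card_le_of_injOn_lattice` — `r` independent integer relations on which an additive map to
  `(2πiℤ)^m ⊆ ℂ^m` is injective force `r ≤ m`.

Everything here is PROVED; no definitions, no named facts.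

## References

* [Waldschmidt2005] M. Waldschmidt, *Variations on the six exponentials theorem*, Algebra and
  Number Theory (Hyderabad 2003), Hindustan Book Agency 2005, 338–355, Thm 2.1, Thm 3.1.
* D. Roy, *Matrices whose coefficients are linear forms in logarithms*, J. Number Theory 41 (1992),
  22–47, §4 Cor. 2.
-/

noncomputable section

open Module Submodule

namespace Literature.NumberTheory.Transcendental.StrongSixExponentials

/-! ### Adapted bases -/

/-- **An adapted basis.** A subspace `V ⊆ ℂ × ℂ^N` containing a vector `e₀` with `e₀.1 = 1` has a
basis `b₀ = e₀`, `bᵢ.1 = 0` (`i ≠ 0`) (prepend `e₀` to a basis of `V ∩ {z = 0}`, `Basis.mkFinCons`),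
and `dim V = m + 1`. [folklore] -/
theorem exists_adapted_basis {N : ℕ} (V : Submodule ℂ (ℂ × (Fin N → ℂ))) (e₀ : ℂ × (Fin N → ℂ))
    (he₀ : e₀ ∈ V) (h1 : e₀.1 = 1) :
    ∃ (m : ℕ) (bV : Basis (Fin (m + 1)) ℂ V), ((bV 0 : V) : ℂ × (Fin N → ℂ)) = e₀ ∧
      (∀ i, i ≠ 0 → ((bV i : V) : ℂ × (Fin N → ℂ)).1 = 0) ∧ finrank ℂ V = m + 1 := by
  let f : V →ₗ[ℂ] ℂ := (LinearMap.fst ℂ ℂ (Fin N → ℂ)).comp V.subtype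
  let N₀ : Submodule ℂ V := LinearMap.ker f
  haveI : Module.Free ℂ N₀ := Module.Free.of_divisionRing ℂ N₀
  let b₀ := Module.finBasis ℂ N₀
  let y : V := ⟨e₀, he₀⟩
  have hli : ∀ (c : ℂ) (x : V), x ∈ N₀ → c • y + x = 0 → c = 0 := by
    intro c x hx h
    have hx1 : (x : ℂ × (Fin N → ℂ)).1 = 0 := hx
    have := congrArg (fun v : V => (v : ℂ × (Fin N → ℂ)).1) h
    simp only [Submodule.coe_add, Submodule.coe_smul_of_tower, Prod.fst_add, Prod.smul_fst, smul_eq_mul,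
      ZeroMemClass.coe_zero, Prod.fst_zero, hx1, add_zero] at this
    simpa [y, h1] using this
  have hsp : ∀ z : V, ∃ c : ℂ, z + c • y ∈ N₀ := by
    intro z
    refine ⟨-(z : ℂ × (Fin N → ℂ)).1, ?_⟩
    show ((z + -(z : ℂ × (Fin N → ℂ)).1 • y : V) : ℂ × (Fin N → ℂ)).1 = 0
    simp [y, h1]
  refine ⟨finrank ℂ N₀, Basis.mkFinCons y b₀ hli hsp, ?_, ?_, ?_⟩
  · simp [Basis.coe_mkFinCons, y]
  · intro i hi
    obtain ⟨j, rfl⟩ := Fin.exists_succ_eq.mpr hi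
    simp only [Basis.coe_mkFinCons, Fin.cons_succ, Function.comp_apply]
    exact (b₀ j).2
  · rw [finrank_eq_card_basis (Basis.mkFinCons y b₀ hli hsp), Fintype.card_fin]

/-- **A `ℚ`-basis beginning with `1`** of a finite-dimensional `ℚ`-algebra with `1 ≠ 0`
(prepend `1` to a basis of a complement of `ℚ·1`). [folklore] -/
theorem exists_basis_head_one (K₀ : Type*) [Field K₀] [Algebra ℚ K₀] [FiniteDimensional ℚ K₀] :
    ∃ (D : ℕ) (ω : Basis (Fin (D + 1)) ℚ K₀), ω 0 = 1 ∧ finrank ℚ K₀ = D + 1 := by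
  obtain ⟨N₁, hN₁⟩ := Submodule.exists_isCompl (Submodule.span ℚ {(1 : K₀)})
  haveI : Module.Free ℚ N₁ := Module.Free.of_divisionRing ℚ N₁
  let b₁ := Module.finBasis ℚ N₁
  have hli : ∀ (c : ℚ) (x : K₀), x ∈ N₁ → c • (1 : K₀) + x = 0 → c = 0 := by
    intro c x hx h
    have hx' : x = -(c • (1 : K₀)) := by rw [eq_neg_iff_add_eq_zero, add_comm]; exact h
    have hmem : x ∈ Submodule.span ℚ {(1 : K₀)} := by
      rw [hx']; exact Submodule.neg_mem _ (Submodule.smul_mem _ _ (Submodule.subset_span rfl))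
    have hx0 : x = 0 := by
      have := Submodule.disjoint_def.mp hN₁.disjoint x hmem hx
      exact this
    rw [hx0, add_zero, smul_eq_zero] at h
    exact h.resolve_right one_ne_zero
  have hsp : ∀ z : K₀, ∃ c : ℚ, z + c • (1 : K₀) ∈ N₁ := by
    intro z
    have hz : z ∈ Submodule.span ℚ {(1 : K₀)} ⊔ N₁ := by rw [hN₁.sup_eq_top]; trivial
    obtain ⟨a, ha, b, hb, hab⟩ := Submodule.mem_sup.mp hz
    obtain ⟨c, rfl⟩ := Submodule.mem_span_singleton.mp ha
    refine ⟨-c, ?_⟩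
    have : z + -c • (1 : K₀) = b := by rw [← hab]; simp
    rw [this]; exact hb
  refine ⟨finrank ℚ N₁, Basis.mkFinCons (1 : K₀) b₁ hli hsp, by simp [Basis.coe_mkFinCons], ?_⟩
  rw [finrank_eq_card_basis (Basis.mkFinCons (1 : K₀) b₁ hli hsp), Fintype.card_fin]

/-! ### Base change of (in)dependence from a subfield of `ℂ` -/

section BaseChange

variable {F : Type*} [Field F] [Algebra F ℂ]

/-- Integer vectors independent over `ℤ` are independent over any field of characteristic zero
mapped into `ℂ` (here: over `ℂ` itself). [folklore] -/
theorem linearIndependent_cast_of_int {l k : ℕ} (χ : Fin k → Fin l → ℤ) (h : LinearIndependent ℤ χ) :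
    LinearIndependent ℂ (fun i j => (χ i j : ℂ)) := by
  have : (fun i j => (χ i j : ℂ)) = fun i => algebraMap ℤ ℂ ∘ χ i := by
    funext i j; simp
  rw [this, linearIndependent_algebraMap_comp_iff]
  exact h

/-- The same over the intermediate field `F`. [folklore] -/
theorem linearIndependent_cast_of_int' {l k : ℕ} (χ : Fin k → Fin l → ℤ) (h : LinearIndependent ℤ χ) :
    LinearIndependent F (fun i j => (χ i j : F)) := by
  have hC := linearIndependent_cast_of_int χ h
  have e : (fun i j => (χ i j : ℂ)) = fun i => algebraMap F ℂ ∘ fun j => (χ i j : F) := by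
    funext i j; simp
  rw [e, linearIndependent_algebraMap_comp_iff] at hC
  exact hC

/-- **Rational choice.** If an `F`-vector lies in the `ℂ`-span of `F`-linearly independent
`F`-vectors, it lies in their `F`-span. [folklore] -/
theorem mem_span_of_mem_span_map {l k : ℕ} (χ : Fin k → Fin l → F) (hχ : LinearIndependent F χ)
    (v : Fin l → F)
    (h : (algebraMap F ℂ ∘ v) ∈ Submodule.span ℂ (Set.range fun i => algebraMap F ℂ ∘ χ i)) :
    v ∈ Submodule.span F (Set.range χ) := by
  by_contra hv
  have hcons : LinearIndependent F (Fin.cons v χ : Fin (k + 1) → Fin l → F) :=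
    linearIndependent_finCons.mpr ⟨hχ, hv⟩
  have hC : LinearIndependent ℂ (fun i => algebraMap F ℂ ∘ (Fin.cons v χ : Fin (k + 1) → Fin l → F) i) :=
    linearIndependent_algebraMap_comp_iff.mpr hcons
  have hC' : LinearIndependent ℂ (Fin.cons (algebraMap F ℂ ∘ v) (fun i => algebraMap F ℂ ∘ χ i) :
      Fin (k + 1) → Fin l → ℂ) := by
    convert hC using 1
    funext i; refine Fin.cases ?_ (fun i' => ?_) i <;> simp
  exact (linearIndependent_finCons.mp hC').2 h

/-- **Rational choice for a pencil.** If some non-trivial `ℂ`-combination `αu + βu'` of two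
`F`-vectors lies in the `ℂ`-span of `F`-independent `F`-vectors `χᵢ`, then some non-trivial
`F`-combination lies in their `F`-span. [folklore] -/
theorem exists_pencil_of_exists_pencil_map {l k : ℕ} (χ : Fin k → Fin l → F) (hχ : LinearIndependent F χ)
    (u u' : Fin l → F)
    (h : ∃ α β : ℂ, (α ≠ 0 ∨ β ≠ 0) ∧
      α • (algebraMap F ℂ ∘ u) + β • (algebraMap F ℂ ∘ u') ∈
        Submodule.span ℂ (Set.range fun i => algebraMap F ℂ ∘ χ i)) :
    ∃ α β : F, (α ≠ 0 ∨ β ≠ 0) ∧ α • u + β • u' ∈ Submodule.span F (Set.range χ) := by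
  classical
  -- the family `(u, u', χ)` is `ℂ`-dependent with a weight on `u` or `u'`
  set fam : Fin (k + 2) → Fin l → F := Fin.cons u (Fin.cons u' χ) with hfam
  have hdep : ¬ LinearIndependent ℂ (fun i => algebraMap F ℂ ∘ fam i) := by
    intro hind
    obtain ⟨α, β, hne, hmem⟩ := h
    obtain ⟨c, hc⟩ := (Submodule.mem_span_range_iff_exists_fun ℂ).mp hmem
    -- a vanishing combination of the independent family
    let g : Fin (k + 2) → ℂ := Fin.cons α (Fin.cons β fun i => -c i)
    have hsum : ∑ i, g i • (algebraMap F ℂ ∘ fam i) = 0 := by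
      rw [Fin.sum_univ_succ, Fin.sum_univ_succ]
      simp only [g, hfam, Fin.cons_zero, Fin.cons_succ, neg_smul, Finset.sum_neg_distrib]
      rw [hc]; abel
    have hg := Fintype.linearIndependent_iff.mp hind g hsum
    rcases hne with hα | hβ
    · exact hα (by simpa [g] using hg 0)
    · exact hβ (by simpa [g] using hg 1)
  rw [linearIndependent_algebraMap_comp_iff] at hdep
  obtain ⟨g, hg, i₀, hi₀⟩ := Fintype.not_linearIndependent_iff.mp hdep
  refine ⟨g 0, g 1, ?_, ?_⟩
  · by_contra hboth
    push Not at hboth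
    obtain ⟨h0, h1⟩ := hboth
    -- then the `χ`-part vanishes, contradicting the independence of `χ`
    have hsum : ∑ i : Fin k, g i.succ.succ • χ i = 0 := by
      have := hg
      rw [Fin.sum_univ_succ, Fin.sum_univ_succ] at this
      have h1' : g (Fin.succ 0) = 0 := h1
      have h1'' : (g 1 : F) = 0 := h1
      simpa [hfam, h0, h1', h1''] using this
    have hz := Fintype.linearIndependent_iff.mp hχ (fun i => g i.succ.succ) hsum
    have : g i₀ = 0 := by
      refine Fin.cases ?_ (fun i => ?_) i₀
      · exact h0
      · refine Fin.cases ?_ (fun i' => ?_) i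
        · exact h1
        · exact hz i'
    exact hi₀ this
  · have : g 0 • u + g 1 • u' = -∑ i : Fin k, g i.succ.succ • χ i := by
      have := hg
      rw [Fin.sum_univ_succ, Fin.sum_univ_succ] at this
      simp only [hfam, Fin.cons_zero, Fin.cons_succ] at this
      rw [eq_neg_iff_add_eq_zero, add_assoc]; exact this
    rw [this]
    exact Submodule.neg_mem _ (Submodule.sum_mem _ fun i _ => Submodule.smul_mem _ _ (Submodule.subset_span ⟨i, rfl⟩))

end BaseChange

/-! ### Independent relations injecting into a lattice -/

/-- **Rank bound.** If `ρ₁, …, ρ_r ∈ ℤ^ℓ` are `ℤ`-independent, `k : ℤ^ℓ → ℂ^m` is additive, injective on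
the group generated by the `ρᵢ`, and `k(ρᵢ) ∈ (2πiℤ)^m`, then `r ≤ m`. [folklore] -/
theorem card_le_of_injOn_lattice {l m r : ℕ} (ρ : Fin r → Fin l → ℤ) (hρ : LinearIndependent ℤ ρ)
    (k : (Fin l → ℤ) →+ (Fin m → ℂ))
    (hinj : ∀ v ∈ Submodule.span ℤ (Set.range ρ), k v = 0 → v = 0)
    (hval : ∀ i, ∃ n : Fin m → ℤ, k (ρ i) = fun j => (2 * Real.pi * Complex.I) * n j) : r ≤ m := by
  classical
  choose n hn using hval
  -- the integer vectors `n i` are `ℤ`-independent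
  have hind : LinearIndependent ℤ n := by
    rw [Fintype.linearIndependent_iff]
    intro g hg
    have h1 : k (∑ i, g i • ρ i) = 0 := by
      rw [map_sum]
      have : ∀ i, k (g i • ρ i) = fun j => (2 * Real.pi * Complex.I) * ((g i • n i) j : ℤ) := by
        intro i
        rw [map_zsmul, hn i]
        funext j; simp; ring
      simp_rw [this]
      funext j
      simp only [Finset.sum_apply, Pi.zero_apply]
      rw [← Finset.mul_sum]
      have : ∑ i, (((g i • n i) j : ℤ) : ℂ) = (((∑ i, g i • n i) j : ℤ) : ℂ) := by
        push_cast [Finset.sum_apply]; rfl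
      rw [this, hg]; simp
    have h2 := hinj _ (Submodule.sum_mem _ fun i _ => Submodule.smul_mem _ _ (Submodule.subset_span ⟨i, rfl⟩)) h1
    exact Fintype.linearIndependent_iff.mp hρ g h2
  have := hind.fintype_card_le_finrank
  simpa using this

end Literature.NumberTheory.Transcendental.StrongSixExponentials

end
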